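/-
Copyright: cell pub-balaban-gaps (YM BLITZ Y1, track G1), seat g1-p2 GEN 4 (unit `pub-balaban-gaps-g1-p2`).  Row (D4) NODE O,
OBJECT ∕ MECHANISM level: the PRODUCT step in the BLOCK currency (`Gaps/D4WalkBlock`, rung §4 of `BLOCKNORM-ADAPTER.md`): the product
of two block walk expansions is a block walk expansion whose per-term block bound sums over the intermediate CUBE only — amplitude
`c·A₁A₂` with NO fibre factor (print's (3.92)→(3.94) count); the repair of the located limit RESIDUE (D4) v1.11 V47 for products.
HONEST FRAMING: bookkeeping over hypothesis SHAPES; nothing of Bałaban's constructed or asserted; (D4) NOT discharged (instance 0∕1);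
NOT BetaPertH, NOT continuum, NOT Clay.
-/
import Summits.QuantumFields.BalabanUV.Gaps.D4WalkBlock
import Summits.QuantumFields.BalabanUV.Gaps.D4WalkProduct

/-!
# `Gaps.D4WalkBlockProduct` — the product of two BLOCK walk expansions: per-term bound over the intermediate cube, no fibre factor
# (cell pub-balaban-gaps, seat g1-p2 gen 4)

HONEST DEPENDENCY (cell pub-balaban, verbatim): continuum YM on T⁴ ⇐ BetaPertH ∧ nine spine estimates (0/9 proved);
BetaPertH ⇐ (D1) ∧ (D4) ∧ CAP+tail.

[B9] (3.92)–(3.94) p. 410, Thm 3.10 p. 416, p. 422.  `blockWalkExpansion_mul`: block walk expansions of `K₁` (rows `p`, middle `n`;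
per-term block rate `ρ₁`, window `ε₁`, torus rate `κ₁`, constant `K̄₁`, distances dominating the cube distance) and of `K₂`
(`n × q`; `ρ₂, ε₂, κ₂, K̄₂`), same σ-region and ball, ONE cube row sum (2.61) at rate `σ` with constant `c` (O(1) at cube rate
O(1): `B13LocalKernelWalks.rowSum_torus`) and one at `σ′`∕`c′` for the partial sums ⟹ `K₁K₂` is a block walk expansion with
amplitudes `c·A₁A₂` — NO fibre factor, by `D4WalkBlock.blockNorm_mul_le` + `B9SectDWalk.conv_walk_le` over cubes —, distance
`D₁ □ D₂`, rate `ρ` (`ρ + σ ≤ ρ₁`, `ρ ≤ ρ₂`), window `ε` inside both windows, torus rate `κ`, constant `c·K̄₁K̄₂c′`.  The entrywise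
`hasSum` is ne5's Cauchy product (`ProductWalks.walkMajorants_mul`, fed the entry bounds read off the blocks — its fibre letter enters
only its own unused constants); `termAnalytic ∕ indep ∕ through` as in `D4WalkProduct.jointWalkExpansion_mul`.
Value: kernel-checked bookkeeping; nothing of Bałaban's asserted; words of row (D4) UNCHANGED.
-/

noncomputable section

namespace Summit.QuantumFields.BalabanUV.Gaps.D4WalkBlockProduct

open Metric Set Finset
open Literature.MathematicalPhysics.QuantumFieldTheory.Balaban1983to89
open Literature.MathematicalPhysics.QuantumFieldTheory.Balaban1983to89.B9SectDWalk
  (Through MajSumLe DomBy infConv le_infConv conv_walk_le through_infConv_left through_infConv_right)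
open Literature.MathematicalPhysics.QuantumFieldTheory.Balaban1983to89.B9Thm34Ext (toB6)
open Literature.MathematicalPhysics.QuantumFieldTheory.Balaban1983to89.B9Thm37GlueTorus
  (torusGeom tdist1 tdist1_nonneg hdnn_torusGeom htri_torusGeom)
open Literature.MathematicalPhysics.QuantumFieldTheory.Balaban1983to89.TreeLengthTorus (TPt)
open Literature.MathematicalPhysics.QuantumFieldTheory.Balaban1983to89.B5TorusCover (UT)
open Literature.MathematicalPhysics.QuantumFieldTheory.Balaban1983to89.B11SectG (RowSum)
open Literature.MathematicalPhysics.QuantumFieldTheory.Balaban1983to89.B13JointWalkExpansion (JointWalkExpansion WalkMajorants)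
open Summit.QuantumFields.BalabanUV.T4Continuum.Spine.NE5.ProductWalks (walkMajorants_mul majSumLe_mul)
open Summit.QuantumFields.BalabanUV.Gaps.D4WalkBlock (blockNorm blockNorm_nonneg blockNorm_mul_le BlockWalkExpansion)
open Summit.QuantumFields.BalabanUV.Gaps.D4WalkProduct (differentiableOn_mul_entry)

variable {ν : ℕ} {K : Fin ν → ℕ} [∀ i, NeZero (K i)]
variable {d N' : ℕ} {p n q : Type} [Fintype p] [Fintype n] [Fintype q]
variable {E : Type*} [NormedAddCommGroup E] [NormedSpace ℂ E]

/-- **PER-TERM BLOCK BOUND OF A PRODUCT — NO FIBRE FACTOR.**  Left factor blocks `≤ A₁e^{−ρ₁D₁}` with `D₁` dominating the cube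
distance, right factor blocks `≤ A₂e^{−ρ₂D₂}`, cube row sum at rate `σ` (constant `c`), `ρ + σ ≤ ρ₁`, `0 ≤ ρ ≤ ρ₂` ⟹
`‖M₁M₂‖_{y,y′} ≤ (c·A₁A₂)·e^{−ρ(D₁ □ D₂)(y,y′)}`. [cite: Balaban1985BackgroundPropagators, (3.92)–(3.94) p.410; Balaban1984PropagatorsII, (2.61) p.234] -/
theorem blockNorm_mul_le_of_walks (cub : p → UT K) (cubn : n → UT K) (cubq : q → UT K)
    {M₁ : Matrix p n ℂ} {M₂ : Matrix n q ℂ} {A₁ A₂ ρ₁ ρ₂ ρ σ c : ℝ} {D₁ D₂ : UT K → UT K → ℝ}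
    (hA₁ : 0 ≤ A₁) (hA₂ : 0 ≤ A₂) (hρ : 0 ≤ ρ) (hρ₂ : ρ ≤ ρ₂) (hσ : 0 ≤ σ) (hρ₁ : ρ + σ ≤ ρ₁)
    (hD₁ : DomBy (toB6 (torusGeom K 0 0 0) 0 True) D₁) (hD₂ : ∀ a b, 0 ≤ D₂ a b) (hrow : RowSum (toB6 (torusGeom K 0 0 0) 0 True) σ c)
    (h₁ : ∀ y y'', blockNorm cub cubn M₁ y y'' ≤ A₁ * Real.exp (-(ρ₁ * D₁ y y'')))
    (h₂ : ∀ y'' y', blockNorm cubn cubq M₂ y'' y' ≤ A₂ * Real.exp (-(ρ₂ * D₂ y'' y'))) (y y' : UT K) :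
    blockNorm cub cubq (M₁ * M₂) y y' ≤
      (c * (A₁ * A₂)) * Real.exp (-(ρ * infConv (g := toB6 (torusGeom K 0 0 0) 0 True) D₁ D₂ y y')) := by
  calc blockNorm cub cubq (M₁ * M₂) y y'
      ≤ ∑ y'' : UT K, blockNorm cub cubn M₁ y y'' * blockNorm cubn cubq M₂ y'' y' := blockNorm_mul_le cub cubn cubq M₁ M₂ y y'
    _ ≤ ∑ y'' : UT K, (A₁ * Real.exp (-(ρ₁ * D₁ y y''))) * (A₂ * Real.exp (-(ρ * D₂ y'' y'))) := by
        refine Finset.sum_le_sum fun y'' _ => mul_le_mul (h₁ y y'') ((h₂ y'' y').trans ?_) (blockNorm_nonneg _ _ _ _ _)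
          (mul_nonneg hA₁ (Real.exp_nonneg _))
        exact mul_le_mul_of_nonneg_left (Real.exp_le_exp.2 (by nlinarith [hD₂ y'' y'])) hA₂
    _ = (A₁ * A₂) * ∑ y'' : UT K, Real.exp (-(ρ₁ * D₁ y y'')) * Real.exp (-(ρ * D₂ y'' y')) := by
        rw [Finset.mul_sum]; exact Finset.sum_congr rfl fun y'' _ => by ring
    _ ≤ (A₁ * A₂) * (c * Real.exp (-(ρ * infConv (g := toB6 (torusGeom K 0 0 0) 0 True) D₁ D₂ y y'))) :=
        mul_le_mul_of_nonneg_left (conv_walk_le (g := toB6 (torusGeom K 0 0 0) 0 True) (hdnn_torusGeom 0 0 0) hrow hσ hρ hρ₁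
          hD₁ y y') (mul_nonneg hA₁ hA₂)
    _ = (c * (A₁ * A₂)) * Real.exp (-(ρ * infConv (g := toB6 (torusGeom K 0 0 0) 0 True) D₁ D₂ y y')) := by ring

variable {c₀ : B13.Consts} {cub : p → UT K} {cubn : n → UT K} {cubq : q → UT K}
variable {K₁ : (TPt d N' → ℂ) → E → Matrix p n ℂ} {K₂ : (TPt d N' → ℂ) → E → Matrix n q ℂ}
variable {X : Finset (UT K)} {R : ℝ}
variable {W₁ W₂ : Type} {T₁ : W₁ → (TPt d N' → ℂ) → E → Matrix p n ℂ} {T₂ : W₂ → (TPt d N' → ℂ) → E → Matrix n q ℂ}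
variable {SX₁ : Set W₁} {SX₂ : Set W₂}
variable {A₁ : W₁ → ℝ} {A₂ : W₂ → ℝ} {D₁ : W₁ → UT K → UT K → ℝ} {D₂ : W₂ → UT K → UT K → ℝ}
variable {ρ₁ ρ₂ ε₁ ε₂ κ₁ κ₂ Kbar₁ Kbar₂ ρ ε κ σ c σ' c' : ℝ}

/-- **THE PRODUCT OF TWO BLOCK WALK EXPANSIONS IS A BLOCK WALK EXPANSION — amplitudes `c·A₁A₂`, NO fibre factor** (left factor
pays).  Rates: `0 ≤ ρ ≤ ρ₂`, `0 ≤ σ`, `ρ + σ ≤ ρ₁`, window `0 ≤ ε`, `ρᵢ − εᵢ ≤ ρ − ε`, torus rates `0 ≤ κ ≤ κ₂`, `κ + σ′ ≤ κ₁`; cube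
row sums `(σ, c)`, `(σ′, c′)`; constant `c·K̄₁K̄₂c′`. [cite: Balaban1985BackgroundPropagators, (3.92)–(3.94) p.410, (3.107)–(3.108) p.416, p.422; Balaban1988RG2Cluster, (1.11) p.5, p.13, p.15; Balaban1984PropagatorsII, (2.61) p.234] -/
theorem blockWalkExpansion_mul
    (h₁ : BlockWalkExpansion c₀ cub cubn K₁ X R ε₁ κ₁ Kbar₁ T₁ SX₁ A₁ D₁ ρ₁)
    (h₂ : BlockWalkExpansion c₀ cubn cubq K₂ X R ε₂ κ₂ Kbar₂ T₂ SX₂ A₂ D₂ ρ₂)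
    (hdom₁ : ∀ ω, DomBy (toB6 (torusGeom K 0 0 0) 0 True) (D₁ ω))
    (hdom₂ : ∀ ω, DomBy (toB6 (torusGeom K 0 0 0) 0 True) (D₂ ω))
    (hrow : RowSum (toB6 (torusGeom K 0 0 0) 0 True) σ c) (hrow' : RowSum (toB6 (torusGeom K 0 0 0) 0 True) σ' c')
    (hρ : 0 ≤ ρ) (hρ₂ : ρ ≤ ρ₂) (hσ : 0 ≤ σ) (hρ₁ : ρ + σ ≤ ρ₁)
    (hε : 0 ≤ ε) (hw₁ : ρ₁ - ε₁ ≤ ρ - ε) (hw₂ : ρ₂ - ε₂ ≤ ρ - ε)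
    (hK₁ : 0 ≤ Kbar₁) (hK₂ : 0 ≤ Kbar₂) (hκ : 0 ≤ κ) (hκ₂ : κ ≤ κ₂) (hκ₁ : κ + σ' ≤ κ₁) (hc : 0 ≤ c) :
    BlockWalkExpansion c₀ cub cubq (fun σ₀ u => K₁ σ₀ u * K₂ σ₀ u) X R ε κ (c * Kbar₁ * Kbar₂ * c')
      (fun (ω : W₁ × W₂) σ₀ u => T₁ ω.1 σ₀ u * T₂ ω.2 σ₀ u) {ω | ω.1 ∈ SX₁ ∨ ω.2 ∈ SX₂}
      (fun ω => c * (A₁ ω.1 * A₂ ω.2))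
      (fun ω => infConv (g := toB6 (torusGeom K 0 0 0) 0 True) (D₁ ω.1) (D₂ ω.2)) ρ := by
  classical
  have hr₁ : ρ₁ - ε₁ ≤ ρ := hw₁.trans (sub_le_self ρ hε)
  have hr₂ : ρ₂ - ε₂ ≤ ρ := hw₂.trans (sub_le_self ρ hε)
  -- the ENTRYWISE Cauchy product (hasSum only; its fibre letter is the trivial bound `card n`)
  have hfib : ∀ y : UT K, (Finset.univ.filter fun k => cubn k = y).card ≤ Fintype.card n :=
    fun y => (Finset.card_filter_le _ _).trans Finset.card_univ.le
  have hJ₁ := h₁.toJoint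
  have hJ₂ := h₂.toJoint
  have hW := walkMajorants_mul hJ₁.hasSum hJ₂.hasSum hJ₁.maj hJ₂.maj h₁.majSum h₂.majSum h₁.A_nonneg h₂.A_nonneg
    h₁.D_nonneg h₂.D_nonneg hdom₁ hfib hrow hrow' hρ hρ₂ hσ hρ₁ hr₁ hr₂ hK₁ hK₂ hκ hκ₂ hκ₁ hc
  exact
  { hasSum := hW.hasSum
    termAnalytic := fun ω σ₀ hσ₀ i j =>
      differentiableOn_mul_entry (fun i k => h₁.termAnalytic ω.1 σ₀ hσ₀ i k) (fun k j => h₂.termAnalytic ω.2 σ₀ hσ₀ k j) i j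
    majB := fun ω σ₀ hσ₀ u hu y y' =>
      blockNorm_mul_le_of_walks cub cubn cubq (h₁.A_nonneg ω.1) (h₂.A_nonneg ω.2) hρ hρ₂ hσ hρ₁ (hdom₁ ω.1) (h₂.D_nonneg ω.2)
        hrow (fun y y'' => h₁.majB ω.1 σ₀ hσ₀ u hu y y'') (fun y'' y' => h₂.majB ω.2 σ₀ hσ₀ u hu y'' y') y y'
    majSum := majSumLe_mul (Nf := K) (C := c) h₁.A_nonneg h₂.A_nonneg h₁.D_nonneg h₂.D_nonneg hw₁ hw₂ hc hK₁ hK₂ hκ hκ₂ hκ₁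
      hrow' h₁.majSum h₂.majSum
    indep := fun ω hω σ₀ hσ₀ => by
      simp only [Set.mem_setOf_eq, not_or] at hω
      show T₁ ω.1 σ₀ 0 * T₂ ω.2 σ₀ 0 = T₁ ω.1 0 0 * T₂ ω.2 0 0
      rw [h₁.indep ω.1 hω.1 σ₀ hσ₀, h₂.indep ω.2 hω.2 σ₀ hσ₀]
    through := fun ω hω => by
      rcases hω with h | h
      · exact through_infConv_left (htri_torusGeom 0 0 0 0 True) (h₁.through ω.1 h) (hdom₂ ω.2)
      · exact through_infConv_right (htri_torusGeom 0 0 0 0 True) (hdom₁ ω.1) (h₂.through ω.2 h)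
    A_nonneg := fun ω => mul_nonneg hc (mul_nonneg (h₁.A_nonneg ω.1) (h₂.A_nonneg ω.2))
    D_nonneg := fun ω a b => le_infConv fun y => add_nonneg (h₁.D_nonneg ω.1 a y) (h₂.D_nonneg ω.2 y b) }

end Summit.QuantumFields.BalabanUV.Gaps.D4WalkBlockProduct

end
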